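import Literature.Probability.LatticeModels.LebowitzPairTruncation
import Literature.Probability.LatticeModels.CorrelationInequalitiesProofs
import HarnessLib

/-!
# The pair-truncation tree bound for the Ising model (Glimm–Jaffe, Cor. 4.3.3) — finite volume and `ℤ^d`

Topic `Probability/LatticeModels`; third of three proof files. Transports the general bound
`gksExpect_two_mul_cov_le_sum_odd` (`LebowitzPairTruncation`) to the tree's Ising vocabulary:

* `isingCorr_two_mul_cov_le_sum_odd` — ferromagnetic nearest-neighbour Ising model on a finite volume
  `Λ` of a locally finite graph, FREE boundary condition, ZERO field, `β ≥ 0`, `A, B ⊆ Λ` even: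
  `2(⟨σ_{A∆B}⟩ - ⟨σ_A⟩⟨σ_B⟩) ≤ ∑_{A₁ ⊆ A, B₁ ⊆ B, |A₁|,|B₁| odd} ⟨σ_{A₁∆B₁}⟩⟨σ_{(A∖A₁)∆(B∖B₁)}⟩`
  [GlimmJaffe1987, Cor. 4.3.3] (via `isingCorr_eq_gksExpect`, the even supports of the free
  zero-field couplings `gksCoupling_free_zero_eq_zero_or_even`, and a reindexing of subsets of `↥Λ`
  by subsets of `V`). The `+` boundary condition is NOT covered in finite volume: its boundary
  field breaks the symmetry `hᵢ ≡ 0` assumed by the source.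
* `freeCorr_two_mul_cov_le_sum_odd` — the free infinite-volume state of `ℤ^d` (box limits,
  `hasBoxLimit_isingCorr_free_holds`, Friedli–Velenik 2017, Exercise 3.16).
* `plusCorr_two_mul_cov_le_sum_odd_of_free_eq_plus` — the plus state whenever it agrees with the
  free state on local spin products, e.g. `m*(β) = 0`
  (`freeCorr_eq_plusCorr_of_spontaneousMagnetization_eq_zero`), in particular at `β_c(d)`, `d ≥ 3`
  (`spontaneousMagnetization_criticalBeta_eq_zero_holds`) — the state of `criticalCorr d` used by
  route `CriticalPhenomena/PrimaryAtInfinity`.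

## References

* [GlimmJaffe1987] Glimm–Jaffe, *Quantum Physics*, 2nd ed., §4.3, Cor. 4.3.3.
* [Lebowitz1974] J. L. Lebowitz, Comm. Math. Phys. 35 (1974) 87–92.
* [FriedliVelenik2017] Friedli–Velenik, *Statistical Mechanics of Lattice Systems*, §3.7.1, Ex. 3.16.
-/

noncomputable section

open Finset
open scoped symmDiff

namespace Literature.Probability.LatticeModels

/-! ### The Ising model with free boundary condition at zero field -/

section Ising

variable {V : Type*} (G : SimpleGraph V) [DecidableEq V] [G.LocallyFinite]

omit [G.LocallyFinite] in
/-- The trace on `Λ` is monotone. [folklore] -/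
theorem inVol_mono (Λ : Finset V) {X Y : Finset V} (h : X ⊆ Y) : inVol Λ X ⊆ inVol Λ Y := by
  intro z hz
  rw [mem_inVol] at hz ⊢
  exact h hz

omit [G.LocallyFinite] in
/-- The trace commutes with set differences. [folklore] -/
theorem inVol_sdiff (Λ X Y : Finset V) : inVol Λ (X \ Y) = inVol Λ X \ inVol Λ Y := by
  ext z
  simp [mem_inVol, Finset.mem_sdiff]

omit [G.LocallyFinite] in
/-- Mapping the trace of `X ⊆ Λ` back to `V` recovers `X`. [folklore] -/
theorem map_inVol_of_subset {Λ X : Finset V} (hX : X ⊆ Λ) :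
    (inVol Λ X).map (Function.Embedding.subtype _) = X := by
  ext v
  simp only [Finset.mem_map, mem_inVol, Function.Embedding.coe_subtype]
  constructor
  · rintro ⟨z, hz, rfl⟩
    exact hz
  · intro hv
    exact ⟨⟨v, hX hv⟩, hv, rfl⟩

omit [G.LocallyFinite] in
/-- The trace of the image of `Y ⊆ ↥Λ` is `Y`. [folklore] -/
theorem inVol_map (Λ : Finset V) (Y : Finset ↥Λ) :
    inVol Λ (Y.map (Function.Embedding.subtype _)) = Y := by
  ext z
  simp only [mem_inVol, Finset.mem_map, Function.Embedding.coe_subtype]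
  constructor
  · rintro ⟨y, hy, hyz⟩
    have : y = z := Subtype.ext hyz
    exact this ▸ hy
  · intro hz
    exact ⟨z, hz, rfl⟩

omit [G.LocallyFinite] in
/-- The trace of `X ⊆ Λ` has the cardinality of `X`. [folklore] -/
theorem card_inVol_of_subset {Λ X : Finset V} (hX : X ⊆ Λ) : (inVol Λ X).card = X.card := by
  conv_rhs => rw [← map_inVol_of_subset hX]
  exact (Finset.card_map _).symm

/-- **Pair-truncation tree bound for the Ising model** (Glimm–Jaffe 1987, Cor. 4.3.3; Lebowitz
1974): ferromagnetic nearest-neighbour Ising model on the finite volume `Λ` of a locally finite graph,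
FREE boundary condition, ZERO field, `β ≥ 0`; for `A, B ⊆ Λ` of even cardinality,
`2(⟨σ_Aσ_B⟩ - ⟨σ_A⟩⟨σ_B⟩) ≤ ∑_{A₁ ⊆ A, B₁ ⊆ B, |A₁|, |B₁| odd} ⟨σ_{A₁}σ_{B₁}⟩ ⟨σ_{A∖A₁}σ_{B∖B₁}⟩`
(with `σ_Xσ_Y = σ_{X∆Y}`, ordered partitions — the printed sum, which is symmetric under
`(A₁,B₁) ↦ (A₂,B₂)`, is twice the sum over unordered partitions, whence the factor `2`; the lower
bound `0 ≤ ⟨σ_Aσ_B⟩ - ⟨σ_A⟩⟨σ_B⟩` is GKS II, `gks_two`). For `A = {a,z}`, `B = {x,y}` this is the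
tree's `gksExpect_cov_spinPair_le`; for `B = {z, y}` and even `X` it reads
`⟨σ_Xσ_zσ_y⟩ - ⟨σ_X⟩⟨σ_zσ_y⟩ ≤ ∑_{Y ⊆ X, |Y| odd} (⟨σ_Yσ_z⟩⟨σ_{X∖Y}σ_y⟩ + ⟨σ_Yσ_y⟩⟨σ_{X∖Y}σ_z⟩)`.
The `+` boundary condition is NOT covered in finite volume (its boundary field breaks the spin-flip
symmetry `hᵢ ≡ 0` of the source). [cite: GlimmJaffe1987, Cor. 4.3.3] [cite: Lebowitz1974, Theorem] -/
theorem isingCorr_two_mul_cov_le_sum_odd {β : ℝ} (hβ : 0 ≤ β) (Λ : Finset V) {A B : Finset V}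
    (hAΛ : A ⊆ Λ) (hBΛ : B ⊆ Λ) (hA : Even A.card) (hB : Even B.card) :
    2 * (isingCorr G Λ β 0 .free (A ∆ B) - isingCorr G Λ β 0 .free A * isingCorr G Λ β 0 .free B) ≤
      ∑ p ∈ (A.powerset ×ˢ B.powerset).filter (fun p => Odd p.1.card ∧ Odd p.2.card),
        isingCorr G Λ β 0 .free (p.1 ∆ p.2) * isingCorr G Λ β 0 .free ((A \ p.1) ∆ (B \ p.2)) := by
  classical
  set s := isingIdx G Λ with hs
  set K := gksCoupling G Λ β 0 .free with hK'
  set C := isingSupp Λ with hC'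
  have hK : ∀ i ∈ s, 0 ≤ K i := gksCoupling_nonneg G hβ le_rfl (Or.inl rfl)
  have hC : ∀ i ∈ s, (C i).card ≤ 2 := fun i _ => card_isingSupp_le_two Λ i
  have heven : ∀ i ∈ s, K i = 0 ∨ Even (C i).card := gksCoupling_free_zero_eq_zero_or_even G Λ β
  have hOdd : ∀ X : Finset ↥Λ, Odd X.card → gksExpect s K C (spinProduct X) = 0 := fun X hX => by
    rw [gksExpect, gksSum_spinProduct_eq_zero_of_odd s K C heven hX, zero_div]
  have hA' : Even (inVol Λ A).card := by rwa [card_inVol_of_subset hAΛ]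
  have hB' : Even (inVol Λ B).card := by rwa [card_inVol_of_subset hBΛ]
  have hmain := gksExpect_two_mul_cov_le_sum_odd s K C hK hC hOdd hA' hB'
  have hABΛ : A ∆ B ⊆ Λ := fun x hx => by
    rw [Finset.mem_symmDiff] at hx
    rcases hx with ⟨h, _⟩ | ⟨h, _⟩
    · exact hAΛ h
    · exact hBΛ h
  -- the finite-volume correlations as `gksExpect`s
  have hcorr : ∀ {X : Finset V}, X ⊆ Λ →
      isingCorr G Λ β 0 .free X = gksExpect s K C (spinProduct (inVol Λ X)) :=
    fun hX => isingCorr_eq_gksExpect G Λ β 0 .free hX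
  rw [hcorr hABΛ, hcorr hAΛ, hcorr hBΛ, inVol_symmDiff]
  refine hmain.trans (le_of_eq ?_)
  -- reindex the sum over subsets of `↥Λ` by subsets of `V`
  symm
  refine Finset.sum_bij' (fun p _ => (inVol Λ p.1, inVol Λ p.2))
    (fun q _ => (q.1.map (Function.Embedding.subtype _), q.2.map (Function.Embedding.subtype _)))
    ?_ ?_ ?_ ?_ ?_
  · intro p hp
    simp only [Finset.mem_filter, Finset.mem_product, Finset.mem_powerset] at hp ⊢
    obtain ⟨⟨h1, h2⟩, h3, h4⟩ := hp
    refine ⟨⟨inVol_mono Λ h1, inVol_mono Λ h2⟩, ?_, ?_⟩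
    · rwa [card_inVol_of_subset (h1.trans hAΛ)]
    · rwa [card_inVol_of_subset (h2.trans hBΛ)]
  · intro q hq
    simp only [Finset.mem_filter, Finset.mem_product, Finset.mem_powerset] at hq ⊢
    obtain ⟨⟨h1, h2⟩, h3, h4⟩ := hq
    refine ⟨⟨?_, ?_⟩, ?_, ?_⟩
    · intro v hv
      obtain ⟨z, hz, rfl⟩ := Finset.mem_map.mp hv
      exact (mem_inVol.mp (h1 hz))
    · intro v hv
      obtain ⟨z, hz, rfl⟩ := Finset.mem_map.mp hv
      exact (mem_inVol.mp (h2 hz))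
    · rwa [Finset.card_map]
    · rwa [Finset.card_map]
  · intro p hp
    simp only [Finset.mem_filter, Finset.mem_product, Finset.mem_powerset] at hp
    obtain ⟨⟨h1, h2⟩, -, -⟩ := hp
    simp only [map_inVol_of_subset (h1.trans hAΛ), map_inVol_of_subset (h2.trans hBΛ)]
  · intro q _
    simp only [inVol_map]
  · intro p hp
    simp only [Finset.mem_filter, Finset.mem_product, Finset.mem_powerset] at hp
    obtain ⟨⟨h1, h2⟩, -, -⟩ := hp
    have hs1 : p.1 ∆ p.2 ⊆ Λ := fun x hx => by
      rw [Finset.mem_symmDiff] at hx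
      rcases hx with ⟨h, _⟩ | ⟨h, _⟩
      · exact hAΛ (h1 h)
      · exact hBΛ (h2 h)
    have hs2 : (A \ p.1) ∆ (B \ p.2) ⊆ Λ := fun x hx => by
      rw [Finset.mem_symmDiff] at hx
      rcases hx with ⟨h, _⟩ | ⟨h, _⟩
      · exact hAΛ (Finset.mem_sdiff.mp h).1
      · exact hBΛ (Finset.mem_sdiff.mp h).1
    rw [hcorr hs1, hcorr hs2, inVol_symmDiff, inVol_symmDiff, inVol_sdiff, inVol_sdiff]

end Ising

/-! ### The free state on `ℤ^d` (and the plus state when it equals the free state) -/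

section Zd

open Filter Topology

variable {d : ℕ}

/-- **Pair-truncation tree bound in the free infinite-volume state of `ℤ^d`** (`β ≥ 0`, zero field,
`|A|, |B|` even): the finite-volume bound `isingCorr_two_mul_cov_le_sum_odd` along the boxes
`B(L) ↑ ℤ^d`, using the box limits `hasBoxLimit_isingCorr_free_holds` (Friedli–Velenik 2017,
Exercise 3.16). [cite: GlimmJaffe1987, Cor. 4.3.3] -/
theorem freeCorr_two_mul_cov_le_sum_odd {β : ℝ} (hβ : 0 ≤ β) {A B : Finset (Site d)}
    (hA : Even A.card) (hB : Even B.card) :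
    2 * (freeCorr d β 0 (A ∆ B) - freeCorr d β 0 A * freeCorr d β 0 B) ≤
      ∑ p ∈ (A.powerset ×ˢ B.powerset).filter (fun p => Odd p.1.card ∧ Odd p.2.card),
        freeCorr d β 0 (p.1 ∆ p.2) * freeCorr d β 0 ((A \ p.1) ∆ (B \ p.2)) := by
  classical
  have hlim : ∀ X : Finset (Site d),
      Tendsto (fun L : ℕ => isingCorr (zdGraph d) (box d L) β 0 .free X) atTop
        (𝓝 (freeCorr d β 0 X)) :=
    fun X => hasBoxLimit_isingCorr_free_holds hβ le_rfl X
  obtain ⟨LA, hLA⟩ := exists_forall_subset_box d A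
  obtain ⟨LB, hLB⟩ := exists_forall_subset_box d B
  have hev : ∀ᶠ L : ℕ in atTop,
      2 * (isingCorr (zdGraph d) (box d L) β 0 .free (A ∆ B) -
          isingCorr (zdGraph d) (box d L) β 0 .free A * isingCorr (zdGraph d) (box d L) β 0 .free B) ≤
        ∑ p ∈ (A.powerset ×ˢ B.powerset).filter (fun p => Odd p.1.card ∧ Odd p.2.card),
          isingCorr (zdGraph d) (box d L) β 0 .free (p.1 ∆ p.2) *
            isingCorr (zdGraph d) (box d L) β 0 .free ((A \ p.1) ∆ (B \ p.2)) := by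
    filter_upwards [eventually_ge_atTop (max LA LB)] with L hL
    exact isingCorr_two_mul_cov_le_sum_odd (zdGraph d) hβ (box d L)
      (hLA L (le_of_max_le_left hL)) (hLB L (le_of_max_le_right hL)) hA hB
  refine le_of_tendsto_of_tendsto ?_ ?_ hev
  · exact ((hlim _).sub ((hlim _).mul (hlim _))).const_mul 2
  · exact tendsto_finsetSum _ fun p _ => (hlim _).mul (hlim _)

/-- **The same bound in the plus state whenever it coincides with the free state on local spin
products** — e.g. when `m*(β) = 0` (`freeCorr_eq_plusCorr_of_spontaneousMagnetization_eq_zero` of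
`PlusFreeComparison`), in particular at `β = β_c(d)` for `d ≥ 3`
(`spontaneousMagnetization_criticalBeta_eq_zero_holds`), the state of `criticalCorr d`. [cite: GlimmJaffe1987, Cor. 4.3.3] -/
theorem plusCorr_two_mul_cov_le_sum_odd_of_free_eq_plus {β : ℝ} (hβ : 0 ≤ β)
    (hfp : ∀ X : Finset (Site d), freeCorr d β 0 X = plusCorr d β 0 X) {A B : Finset (Site d)}
    (hA : Even A.card) (hB : Even B.card) :
    2 * (plusCorr d β 0 (A ∆ B) - plusCorr d β 0 A * plusCorr d β 0 B) ≤
      ∑ p ∈ (A.powerset ×ˢ B.powerset).filter (fun p => Odd p.1.card ∧ Odd p.2.card),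
        plusCorr d β 0 (p.1 ∆ p.2) * plusCorr d β 0 ((A \ p.1) ∆ (B \ p.2)) := by
  simp only [← hfp]
  exact freeCorr_two_mul_cov_le_sum_odd hβ hA hB

end Zd

end Literature.Probability.LatticeModels

end
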